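import Summits.QuantumFields.YangMills.Theorems.SqueezedSkewnessThermalLimitFinTorusSlabCycle
import Literature.Analysis.OperatorTheory.PositiveKernelSpectralTraceTwo
import Summits.QuantumFields.YangMills.Theorems.SqueezedSkewnessThermalLimitSpectralSums
import HarnessLib

/-!
# Route `SqueezedSkewness`, support `ThermalLimit` (stmt-QuantumFields-22661) — engine layer (B):
# WINDOW OBSERVABLES OF THE ANISOTROPIC `Fin`-TORUS AS ONE-INSERTION TRANSFER-MATRIX TRACES, AND THEIR
# THERMODYNAMIC (INFINITE EUCLIDEAN TIME) LIMIT

The `Fin`-torus twin of the `ZMod`-torus slab correlators `WilsonTorusSlabCorrelators` (p644993), for observables of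
ARBITRARY finite time-width.  Setting: the anisotropic box `b₁ × b₂ × b₃ × T` of `wilsonFinTorusPartition ρ β b₁ b₂ b₃ T`
(time = the LAST axis, the convention of `SqueezedSkewness.ThermalLimit`), continuous unitary `ρ`, `β ≥ 0`; the slicing
`finTorusAssemble (V, E)` of `WilsonFinTorusSliceKernel` (spatial slices `V t`, temporal links `E t`), the symmetrised slab
weight `c(a, g, b) = e^{−βS_sp(a)/2} e^{−βS_tm(a,g,b)} e^{−βS_sp(b)/2}` (written out; `∫ c dg = finTorusSliceKernel`), and the
abstract slab toolkit `Literature.Analysis.OperatorTheory.slab_cyclic_one` ∕ `integral_cyclic_insert_one` ∕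
`hasSum_integral_iterate_insert_one`.  A **window observable** of width `r + 1` based at the site `c` of the time cycle is
a measurable `Φ` on link configurations with `Φ(asm(V, E)) = α(V_{c}, …, V_{c+r+1}; E_{c}, …, E_{c+r})` for a bounded
measurable `α` — e.g. any polynomial in plaquette traces (spatial AND temporal) based at sites of times `c, …, c + r`.

PROVED (theorems only, no definitions; everything `[folklore]` transfer-matrix bookkeeping):
* (layer (B1) `…FinTorusSlabCycle`: `∫ Φ e^{−βS} ∏dU = ∫ Φ(asm(V,E)) ∏ₜ c(Vₜ,Eₜ,Vₜ₊₁)`, in `Fin`- and `ZMod`-indexed letters);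
* §4 `hasSum_window_rotated` — **`∫ Φ e^{−βS} = Σᵢ λᵢ^{M+2} ⟪bᵢ, 𝕏_α bᵢ⟫`** for `T = M + r + 3`, any
  orthonormal eigenbasis `(bᵢ, λᵢ)` of the transfer operator and any bounded operator `𝕏_α` with the contracted block kernel
  (Montvay–Münster (1.195)–(1.196) `⟨O⟩·Z = Tr(Ô T^{N−w})`); windows at any base site by rotation invariance of the cycle;
* §5 `exists_window_spectralData` — the package: ONE eigen-data `0 ≤ λᵢ ≤ λ_{i₀}`, `0 < λ_{i₀}`, `Σλ² < ∞`, `Z(m+2) = Σλᵢ^{m+2}`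
  and, per window function `α`, bounded coefficients `aᵢ` with `∫ Φ e^{−βS} = Σᵢ λᵢ^{M+2} aᵢ` for EVERY period and base site;
* §6 `exists_tendsto_window_expectation` (**main**) — for periods `T k → ∞` and observables `Φ k` reading one fixed `α` on
  some window of each torus, `⟨Φ k⟩ = ∫ Φ k e^{−βS} / Z(T k)` CONVERGES (layer (A) `SpectralSumLimit`, p650121: no spectral gap
  needed, Lüscher positivity suffices).
Layer (C) (the item's let-chain: `Qrp = Cov(B∘refl, B)` as three window observables of width `2L + 2` for
`T_k = 2^k(2L+1)`) is the remaining step.  Width seat `ym-t4-w9` (cell ym-fleet), `--supports stmt-QuantumFields-22661`;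
rung R2a plumbing; no summit ∕ NT ∕ UV ∕ IR ∕ mass-gap statement is proved.

References: I. Montvay, G. Münster, *Quantum Fields on a Lattice* (1994) §1.5.2 (1.195)–(1.196), §3.2.6 (3.137)–(3.146);
M. Lüscher, Commun. Math. Phys. 54 (1977) 283; K. Osterwalder, E. Seiler, Ann. Phys. 110 (1978) 440, §§2–3.
-/

set_option autoImplicit false

noncomputable section

open scoped BigOperators ENNReal
open MeasureTheory Filter Function Topology
open Literature.MathematicalPhysics.QuantumFieldTheory
open Literature.Analysis.OperatorTheory
open Summit.QuantumFields.YangMills.Theorems.FinTorusSlabCycle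

namespace Summit.QuantumFields.YangMills.Theorems.FinTorusWindow

variable {b₁ b₂ b₃ : ℕ} {G : Type*} [Group G] [TopologicalSpace G] [IsTopologicalGroup G] [CompactSpace G]
  [MeasurableSpace G] [BorelSpace G] [SecondCountableTopology G] {N : ℕ} (ρ : G →* Matrix (Fin N) (Fin N) ℂ) (β : ℝ)

/-! ## §4 Window observables (any base site of the time cycle) are one-insertion transfer-matrix traces -/

/-- **WINDOW OBSERVABLES BASED AT AN ARBITRARY SITE `c` OF THE TIME CYCLE**: the conclusion of `hasSum_window` for an
observable reading `α` on the slices `c, c+1, …, c+r+1` (cyclically) and the temporal links between them — the cyclic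
slab integral is invariant under rotations of the time cycle (time-translation invariance of the torus Gibbs weight).
[cite: MontvayMunster1994, §1.5.2 (1.195)–(1.196)] -/
theorem hasSum_window_rotated (hρ : Continuous ρ) (hρu : ∀ g, ρ g ∈ Matrix.unitaryGroup (Fin N) ℂ) (hβ : 0 ≤ β)
    {T r M : ℕ} (hT : T = M + r + 3) (hr2 : r + 2 ≤ T) (hr1 : r + 1 ≤ T) (c : Fin T)
    {α : (Fin (r + 2) → (FinSpatialSite b₁ b₂ b₃ × Fin 3 → G)) → (Fin (r + 1) → (FinSpatialSite b₁ b₂ b₃ → G)) → ℝ}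
    (hα : Measurable fun q : (Fin (r + 2) → (FinSpatialSite b₁ b₂ b₃ × Fin 3 → G)) ×
      (Fin (r + 1) → (FinSpatialSite b₁ b₂ b₃ → G)) => α q.1 q.2)
    {Cα : ℝ} (hαb : ∀ W γs, |α W γs| ≤ Cα)
    {Φ : (FinTorusSite b₁ b₂ b₃ T × Fin 4 → G) → ℝ} (hΦ : Measurable Φ)
    (hΦα : ∀ VE : (Fin T → (FinSpatialSite b₁ b₂ b₃ × Fin 3 → G)) × (Fin T → (FinSpatialSite b₁ b₂ b₃ → G)),
      Φ (finTorusAssemble VE) = α (fun i => VE.1 (Fin.castLE hr2 i + c)) (fun i => VE.2 (Fin.castLE hr1 i + c)))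
    {ι : Type*} [Countable ι]
    {b : HilbertBasis ι ℝ (Lp ℝ 2 (Measure.pi fun _ : FinSpatialSite b₁ b₂ b₃ × Fin 3 => haarProbability G))}
    {lam : ι → ℝ}
    {A : Lp ℝ 2 (Measure.pi fun _ : FinSpatialSite b₁ b₂ b₃ × Fin 3 => haarProbability G) →L[ℝ]
      Lp ℝ 2 (Measure.pi fun _ : FinSpatialSite b₁ b₂ b₃ × Fin 3 => haarProbability G)}
    (hA : ∀ φ, (A φ : (FinSpatialSite b₁ b₂ b₃ × Fin 3 → G) → ℝ)
      =ᵐ[Measure.pi fun _ : FinSpatialSite b₁ b₂ b₃ × Fin 3 => haarProbability G]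
        fun x => ∫ y, finTorusSliceKernel ρ β x y * φ y ∂(Measure.pi fun _ : FinSpatialSite b₁ b₂ b₃ × Fin 3 => haarProbability G))
    (hb : ∀ i, A (b i) = lam i • b i)
    {Xop : Lp ℝ 2 (Measure.pi fun _ : FinSpatialSite b₁ b₂ b₃ × Fin 3 => haarProbability G) →L[ℝ]
      Lp ℝ 2 (Measure.pi fun _ : FinSpatialSite b₁ b₂ b₃ × Fin 3 => haarProbability G)}
    (hXop : ∀ φ, (Xop φ : (FinSpatialSite b₁ b₂ b₃ × Fin 3 → G) → ℝ)
      =ᵐ[Measure.pi fun _ : FinSpatialSite b₁ b₂ b₃ × Fin 3 => haarProbability G]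
        fun u => ∫ u', (∫ v : Fin r → (FinSpatialSite b₁ b₂ b₃ × Fin 3 → G),
            ∫ γs : Fin (r + 1) → (FinSpatialSite b₁ b₂ b₃ → G),
              α (Fin.cons u (Fin.snoc v u')) γs * ∏ i : Fin (r + 1),
                (Real.exp (-(β * finTorusSpatialAction ρ ((Fin.cons u (Fin.snoc v u') :
                    Fin (r + 2) → (FinSpatialSite b₁ b₂ b₃ × Fin 3 → G)) (Fin.castSucc i)) / 2)) *
                  Real.exp (-(β * finTorusTemporalAction ρ ((Fin.cons u (Fin.snoc v u') :
                    Fin (r + 2) → (FinSpatialSite b₁ b₂ b₃ × Fin 3 → G)) (Fin.castSucc i)) (γs i)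
                    ((Fin.cons u (Fin.snoc v u') : Fin (r + 2) → (FinSpatialSite b₁ b₂ b₃ × Fin 3 → G)) (Fin.succ i)))) *
                  Real.exp (-(β * finTorusSpatialAction ρ ((Fin.cons u (Fin.snoc v u') :
                    Fin (r + 2) → (FinSpatialSite b₁ b₂ b₃ × Fin 3 → G)) (Fin.succ i)) / 2)))
              ∂(Measure.pi fun _ => Measure.pi fun _ : FinSpatialSite b₁ b₂ b₃ => haarProbability G)
            ∂(Measure.pi fun _ => Measure.pi fun _ : FinSpatialSite b₁ b₂ b₃ × Fin 3 => haarProbability G)) * φ u'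
          ∂(Measure.pi fun _ : FinSpatialSite b₁ b₂ b₃ × Fin 3 => haarProbability G)) :
    HasSum (fun i => lam i ^ (M + 2) * @inner ℝ _ _ (b i) (Xop (b i)))
      (∫ U, Φ U * Real.exp (-β * ∑ x : FinTorusSite b₁ b₂ b₃ T, ∑ q : {q : Fin 4 × Fin 4 // q.1 < q.2},
        ((N : ℝ) - (ρ (finTorusPlaquette U x q.1.1 q.1.2)).trace.re))
        ∂(Measure.pi fun _ : FinTorusSite b₁ b₂ b₃ T × Fin 4 => haarProbability G)) := by
  -- the period in successor form
  obtain ⟨k, rfl⟩ : ∃ k, T = k + 1 := ⟨M + r + 2, by omega⟩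
  -- the slab weight `c` (a local abbreviation) and the kernel facts
  set cw : (FinSpatialSite b₁ b₂ b₃ × Fin 3 → G) → (FinSpatialSite b₁ b₂ b₃ → G) →
      (FinSpatialSite b₁ b₂ b₃ × Fin 3 → G) → ℝ :=
    fun a g b => Real.exp (-(β * finTorusSpatialAction ρ a / 2)) * Real.exp (-(β * finTorusTemporalAction ρ a g b)) *
      Real.exp (-(β * finTorusSpatialAction ρ b / 2)) with hcw_def
  have hK := stronglyMeasurable_uncurry_finTorusSliceKernel (b₁ := b₁) (b₂ := b₂) (b₃ := b₃) ρ hρ β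
  obtain ⟨CK, hCK⟩ := exists_norm_finTorusSliceKernel_le (b₁ := b₁) (b₂ := b₂) (b₃ := b₃) ρ hρ β
  have hsymm := finTorusSliceKernel_symm (b₁ := b₁) (b₂ := b₂) (b₃ := b₃) ρ hρu β
  have hc : Measurable fun q : (FinSpatialSite b₁ b₂ b₃ × Fin 3 → G) × (FinSpatialSite b₁ b₂ b₃ → G) ×
      (FinSpatialSite b₁ b₂ b₃ × Fin 3 → G) => cw q.1 q.2.1 q.2.2 :=
    measurable_slabWeight (b₁ := b₁) (b₂ := b₂) (b₃ := b₃) ρ β hρ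
  have hcb : ∀ a g b, 0 ≤ cw a g b ∧ cw a g b ≤ 1 :=
    slabWeight_nonneg_le_one (b₁ := b₁) (b₂ := b₂) (b₃ := b₃) ρ β hρu hβ
  have hcK : ∀ a b, ∫ g, cw a g b ∂(Measure.pi fun _ : FinSpatialSite b₁ b₂ b₃ => haarProbability G) =
      finTorusSliceKernel ρ β a b := integral_slabWeight (b₁ := b₁) (b₂ := b₂) (b₃ := b₃) ρ β
  have hX := slab_blockKernel_stronglyMeasurable
    (μ := Measure.pi fun _ : FinSpatialSite b₁ b₂ b₃ × Fin 3 => haarProbability G)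
    (ν := Measure.pi fun _ : FinSpatialSite b₁ b₂ b₃ => haarProbability G) hc hα
  have hCX' := slab_blockKernel_abs_le'
    (μ := Measure.pi fun _ : FinSpatialSite b₁ b₂ b₃ × Fin 3 => haarProbability G)
    (ν := Measure.pi fun _ : FinSpatialSite b₁ b₂ b₃ => haarProbability G) hc hcb hαb
  simp only [one_pow, mul_one] at hCX'
  have hCX : ∀ u u', ‖(fun u u' : FinSpatialSite b₁ b₂ b₃ × Fin 3 → G =>
      ∫ v : Fin r → (FinSpatialSite b₁ b₂ b₃ × Fin 3 → G), ∫ γs : Fin (r + 1) → (FinSpatialSite b₁ b₂ b₃ → G),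
        α (Fin.cons u (Fin.snoc v u')) γs * ∏ i : Fin (r + 1),
          cw ((Fin.cons u (Fin.snoc v u') : Fin (r + 2) → (FinSpatialSite b₁ b₂ b₃ × Fin 3 → G)) (Fin.castSucc i)) (γs i)
            ((Fin.cons u (Fin.snoc v u') : Fin (r + 2) → (FinSpatialSite b₁ b₂ b₃ × Fin 3 → G)) (Fin.succ i))
        ∂(Measure.pi fun _ => Measure.pi fun _ : FinSpatialSite b₁ b₂ b₃ => haarProbability G)
      ∂(Measure.pi fun _ => Measure.pi fun _ : FinSpatialSite b₁ b₂ b₃ × Fin 3 => haarProbability G)) u u'‖ ≤ Cα :=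
    fun u u' => by rw [Real.norm_eq_abs]; exact hCX' u u'
  have hmX : ∀ u u', ‖(fun u u' : FinSpatialSite b₁ b₂ b₃ × Fin 3 → G =>
      ∫ v : Fin r → (FinSpatialSite b₁ b₂ b₃ × Fin 3 → G), ∫ γs : Fin (r + 1) → (FinSpatialSite b₁ b₂ b₃ → G),
        α (Fin.cons u (Fin.snoc v u')) γs * ∏ i : Fin (r + 1),
          cw ((Fin.cons u (Fin.snoc v u') : Fin (r + 2) → (FinSpatialSite b₁ b₂ b₃ × Fin 3 → G)) (Fin.castSucc i)) (γs i)
            ((Fin.cons u (Fin.snoc v u') : Fin (r + 2) → (FinSpatialSite b₁ b₂ b₃ × Fin 3 → G)) (Fin.succ i))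
        ∂(Measure.pi fun _ => Measure.pi fun _ : FinSpatialSite b₁ b₂ b₃ => haarProbability G)
      ∂(Measure.pi fun _ => Measure.pi fun _ : FinSpatialSite b₁ b₂ b₃ × Fin 3 => haarProbability G)) u u'‖ ≤ max Cα CK :=
    fun u u' => (hCX u u').trans (le_max_left _ _)
  have hmK : ∀ x y, ‖finTorusSliceKernel ρ β x y‖ ≤ max Cα CK := fun x y => (hCK x y).trans (le_max_right _ _)
  -- the cyclic slab integral with the rotated window, rotated back to the standard window
  have hwin : ∀ p : (ZMod (k + 1) → (FinSpatialSite b₁ b₂ b₃ × Fin 3 → G)) × (ZMod (k + 1) → (FinSpatialSite b₁ b₂ b₃ → G)),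
      Φ (finTorusAssemble (fun t : Fin (k + 1) => p.1 ((t : ℕ) : ZMod (k + 1)),
          fun t : Fin (k + 1) => p.2 ((t : ℕ) : ZMod (k + 1)))) =
        α (fun i : Fin (r + 2) => p.1 (((i : ℕ) : ZMod (k + 1)) + ((c : ℕ) : ZMod (k + 1))))
          (fun i : Fin (r + 1) => p.2 (((i : ℕ) : ZMod (k + 1)) + ((c : ℕ) : ZMod (k + 1)))) := by
    intro p
    rw [hΦα]
    simp only [cast_castLE_add]
  have key : ∫ U, Φ U * Real.exp (-β * ∑ x : FinTorusSite b₁ b₂ b₃ (k + 1), ∑ q : {q : Fin 4 × Fin 4 // q.1 < q.2},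
        ((N : ℝ) - (ρ (finTorusPlaquette U x q.1.1 q.1.2)).trace.re))
        ∂(Measure.pi fun _ : FinTorusSite b₁ b₂ b₃ (k + 1) × Fin 4 => haarProbability G) =
      ∫ p : (ZMod (k + 1) → (FinSpatialSite b₁ b₂ b₃ × Fin 3 → G)) × (ZMod (k + 1) → (FinSpatialSite b₁ b₂ b₃ → G)),
        α (fun i : Fin (r + 2) => p.1 ((i : ℕ) : ZMod (k + 1))) (fun i : Fin (r + 1) => p.2 ((i : ℕ) : ZMod (k + 1))) *
          ∏ s : ZMod (k + 1), cw (p.1 s) (p.2 s) (p.1 (s + 1))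
        ∂((Measure.pi fun _ : ZMod (k + 1) => Measure.pi fun _ : FinSpatialSite b₁ b₂ b₃ × Fin 3 => haarProbability G).prod
          (Measure.pi fun _ : ZMod (k + 1) => Measure.pi fun _ : FinSpatialSite b₁ b₂ b₃ => haarProbability G)) := by
    rw [integral_mul_weight_eq_slab_zmod ρ β hρ hΦ,
      ← integral_rotate_zmod (Measure.pi fun _ : FinSpatialSite b₁ b₂ b₃ × Fin 3 => haarProbability G)
        (Measure.pi fun _ : FinSpatialSite b₁ b₂ b₃ => haarProbability G) ((c : ℕ) : ZMod (k + 1))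
        (fun p : (ZMod (k + 1) → (FinSpatialSite b₁ b₂ b₃ × Fin 3 → G)) × (ZMod (k + 1) → (FinSpatialSite b₁ b₂ b₃ → G)) =>
          α (fun i : Fin (r + 2) => p.1 ((i : ℕ) : ZMod (k + 1))) (fun i : Fin (r + 1) => p.2 ((i : ℕ) : ZMod (k + 1))) *
            ∏ s : ZMod (k + 1), cw (p.1 s) (p.2 s) (p.1 (s + 1)))]
    refine integral_congr_ae (Eventually.of_forall fun p => ?_)
    dsimp only
    rw [hwin]
    congr 1
    -- the cyclic weight product is rotation invariant
    exact (Fintype.prod_equiv (Equiv.addRight ((c : ℕ) : ZMod (k + 1))) _ _ fun s => by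
      simp only [Equiv.coe_addRight, add_right_comm s 1 ((c : ℕ) : ZMod (k + 1)), hcw_def]).symm
  rw [key, slab_cyclic_one (μ := Measure.pi fun _ : FinSpatialSite b₁ b₂ b₃ × Fin 3 => haarProbability G)
    (ν := Measure.pi fun _ : FinSpatialSite b₁ b₂ b₃ => haarProbability G) hc hcb hα hαb (N := k + 1) (M := M + 1)
    (by omega)]
  simp_rw [hcK]
  -- the one-insertion cycle and its spectral sum
  have hc1 := integral_cyclic_insert_one (ρ := Measure.pi fun _ : FinSpatialSite b₁ b₂ b₃ × Fin 3 => haarProbability G)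
    hX.measurable hK.measurable hmX hmK (M + 1)
  have h8 := hasSum_integral_iterate_insert_one hK hCK hsymm hA hb hX hCX hXop M
  rw [← hc1] at h8
  exact h8

/-! ## §5 The spectral package: eigen-data of the transfer matrix and, per window, its insertion coefficients -/

/-- **THE SPECTRAL PACKAGE OF THE ANISOTROPIC `Fin`-TORUS** (`β ≥ 0`, continuous unitary `ρ`, any box `b₁ × b₂ × b₃`):
eigen-data `0 ≤ λᵢ ≤ λ_{i₀}`, `0 < λ_{i₀}`, `Σ λᵢ² < ∞` of the transfer operator of `finTorusSliceKernel ρ β` with the trace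
formula `Z(m+2) = Σᵢ λᵢ^{m+2}` (verbatim ✓`exists_spectralData_wilsonFinTorusPartition_box`), AND for every bounded
measurable window function `α` of `r + 2` slices ∕ `r + 1` temporal-link layers a bounded coefficient family `aᵢ`
(`= ⟪bᵢ, 𝕏_α bᵢ⟫`) such that EVERY measurable observable of EVERY period `T = M + r + 3` that reads `α` on the window
`[0, r+1]` has un-normalised expectation `Σᵢ λᵢ^{M+2} aᵢ` — one transfer operator, one eigenbasis for all periods and all
windows; the window may sit at any base site `c` of the time cycle. [cite: MontvayMunster1994, §1.5.2 (1.195)–(1.196)] [cite: Luscher1977] -/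
theorem exists_window_spectralData (hρ : Continuous ρ) (hρu : ∀ g, ρ g ∈ Matrix.unitaryGroup (Fin N) ℂ) (hβ : 0 ≤ β)
    (b₁ b₂ b₃ : ℕ) :
    ∃ (s : Set (Lp ℝ 2 (Measure.pi fun _ : FinSpatialSite b₁ b₂ b₃ × Fin 3 => haarProbability G)))
      (_ : Countable s) (lam : s → ℝ) (i₀ : s),
      (∀ i, 0 ≤ lam i ∧ lam i ≤ lam i₀) ∧ 0 < lam i₀ ∧ Summable (fun i => lam i ^ 2) ∧
      (∀ m : ℕ, HasSum (fun i => lam i ^ (m + 2)) (wilsonFinTorusPartition ρ β b₁ b₂ b₃ (m + 2))) ∧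
      ∀ (r : ℕ) (α : (Fin (r + 2) → (FinSpatialSite b₁ b₂ b₃ × Fin 3 → G)) → (Fin (r + 1) → (FinSpatialSite b₁ b₂ b₃ → G)) → ℝ),
        (Measurable fun q : (Fin (r + 2) → (FinSpatialSite b₁ b₂ b₃ × Fin 3 → G)) ×
          (Fin (r + 1) → (FinSpatialSite b₁ b₂ b₃ → G)) => α q.1 q.2) →
        ∀ Cα : ℝ, (∀ W γs, |α W γs| ≤ Cα) →
          ∃ a : s → ℝ, (∃ Ca : ℝ, ∀ i, |a i| ≤ Ca) ∧
            ∀ (T M : ℕ) (_hT : T = M + r + 3) (hr2 : r + 2 ≤ T) (hr1 : r + 1 ≤ T) (c : Fin T)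
              (Φ : (FinTorusSite b₁ b₂ b₃ T × Fin 4 → G) → ℝ), Measurable Φ →
              (∀ VE : (Fin T → (FinSpatialSite b₁ b₂ b₃ × Fin 3 → G)) × (Fin T → (FinSpatialSite b₁ b₂ b₃ → G)),
                Φ (finTorusAssemble VE) = α (fun i => VE.1 (Fin.castLE hr2 i + c)) (fun i => VE.2 (Fin.castLE hr1 i + c))) →
              HasSum (fun i => lam i ^ (M + 2) * a i)
                (∫ U, Φ U * Real.exp (-β * ∑ x : FinTorusSite b₁ b₂ b₃ T, ∑ q : {q : Fin 4 × Fin 4 // q.1 < q.2},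
                  ((N : ℝ) - (ρ (finTorusPlaquette U x q.1.1 q.1.2)).trace.re))
                  ∂(Measure.pi fun _ : FinTorusSite b₁ b₂ b₃ T × Fin 4 => haarProbability G)) := by
  set μ : Measure (FinSpatialSite b₁ b₂ b₃ × Fin 3 → G) :=
    Measure.pi fun _ : FinSpatialSite b₁ b₂ b₃ × Fin 3 => haarProbability G with hμ
  set K : (FinSpatialSite b₁ b₂ b₃ × Fin 3 → G) → (FinSpatialSite b₁ b₂ b₃ × Fin 3 → G) → ℝ :=
    finTorusSliceKernel ρ β with hKdef
  have hK : StronglyMeasurable (uncurry K) := stronglyMeasurable_uncurry_finTorusSliceKernel ρ hρ β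
  obtain ⟨C, hC⟩ := exists_norm_finTorusSliceKernel_le (b₁ := b₁) (b₂ := b₂) (b₃ := b₃) ρ hρ β
  have hsymm : ∀ x y, K x y = K y x := finTorusSliceKernel_symm ρ hρu β
  have hKpos : ∀ x y, 0 < K x y := finTorusSliceKernel_pos ρ hρ β
  -- the transfer operator on `L²` of the spatial links
  obtain ⟨A, hA⟩ := exists_kernelOp (μ := μ) hK hC
  have hsa : IsSelfAdjoint A := isSelfAdjoint_kernelOp hK hC hsymm hA
  have hC0 : 0 ≤ C := (norm_nonneg _).trans (hC 1 1)
  have hcpt : IsCompactOperator A := isCompactOperator_kernelOp hC hC0 hA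
  have himp : IsPositivityImproving A := isPositivityImproving_kernelOp hK hC hKpos hA
  have hA0 : A ≠ 0 := kernelOp_ne_zero hK hC hKpos (IsProbabilityMeasure.ne_zero _) hA
  -- an eigenbasis (Hilbert–Schmidt theorem), countable by separability of `L²`
  obtain ⟨s, b, lam, hbs, hb0⟩ := exists_hilbertBasis_eigenvectors_of_isSelfAdjoint hcpt hsa
  have hb : ∀ i, A (b i) = lam i • b i := fun i => by simpa using hb0 i
  haveI : Fact ((2 : ℝ≥0∞) ≠ ⊤) := ⟨ENNReal.ofNat_ne_top⟩
  have hon : Orthonormal ℝ ((↑) : s → Lp ℝ 2 μ) := hbs ▸ b.orthonormal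
  have hcnt : Countable s := (hon.countable_of_separableSpace (𝕜 := ℝ)).to_subtype
  haveI : Countable s := hcnt
  -- non-negative eigenvalues (Lüscher), top eigenvalue `λ_{i₀} = ‖A‖ > 0` (Jentzsch), `Σ λ² < ∞`
  have hlam0 : ∀ i, 0 ≤ lam i := fun i => by
    rw [lam_eq_inner hb i]
    exact inner_kernelOp_self_nonneg hA (posType_finTorusSliceKernel ρ hρ hρu hβ) _
  obtain ⟨ψ, hψ0, hψ⟩ := himp.exists_top_eigenvector_of_isCompactOperator hsa hcpt hA0
  obtain ⟨i₀, hi₀⟩ := exists_index_eq_norm b hsa hb hψ0 hψ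
  have hle : ∀ i, lam i ≤ lam i₀ := fun i => (le_abs_self _).trans ((abs_lam_le_norm hb i).trans hi₀.ge)
  have hL0 : 0 < lam i₀ := by rw [hi₀]; exact norm_pos_iff.2 hA0
  have hS := hasSum_lam_sq hK hC hA hb
  -- the trace formula for the partition function
  have hZ : ∀ m : ℕ, HasSum (fun i => lam i ^ (m + 2)) (wilsonFinTorusPartition ρ β b₁ b₂ b₃ (m + 2)) := fun m => by
    rw [wilsonFinTorusPartition_eq_integral_prod_finTorusSliceKernel_succ ρ hρ β b₁ b₂ b₃ m]
    exact hasSum_pow_integral_cyclic hK hC hsymm hA hb hlam0 m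
  refine ⟨s, hcnt, lam, i₀, fun i => ⟨hlam0 i, hle i⟩, hL0, hS.summable, hZ, ?_⟩
  -- per window: the insertion operator `𝕏_α` and its diagonal coefficients
  intro r α hα Cα hαb
  have hc := measurable_slabWeight (b₁ := b₁) (b₂ := b₂) (b₃ := b₃) ρ β hρ
  have hcb := slabWeight_nonneg_le_one (b₁ := b₁) (b₂ := b₂) (b₃ := b₃) ρ β hρu hβ
  have hX := slab_blockKernel_stronglyMeasurable (μ := μ)
    (ν := Measure.pi fun _ : FinSpatialSite b₁ b₂ b₃ => haarProbability G)
    (c := fun a g b => Real.exp (-(β * finTorusSpatialAction ρ a / 2)) * Real.exp (-(β * finTorusTemporalAction ρ a g b)) *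
      Real.exp (-(β * finTorusSpatialAction ρ b / 2))) hc hα
  have hCX' := slab_blockKernel_abs_le' (μ := μ)
    (ν := Measure.pi fun _ : FinSpatialSite b₁ b₂ b₃ => haarProbability G)
    (c := fun a g b => Real.exp (-(β * finTorusSpatialAction ρ a / 2)) * Real.exp (-(β * finTorusTemporalAction ρ a g b)) *
      Real.exp (-(β * finTorusSpatialAction ρ b / 2))) hc hcb hαb
  simp only [one_pow, mul_one] at hCX'
  obtain ⟨Xop, hXop⟩ := exists_kernelOp (μ := μ) hX (fun u u' => by rw [Real.norm_eq_abs]; exact hCX' u u')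
  refine ⟨fun i => @inner ℝ _ _ (b i) (Xop (b i)), ⟨‖Xop‖, fun i => ?_⟩, ?_⟩
  · -- `|⟪bᵢ, 𝕏 bᵢ⟫| ≤ ‖𝕏‖` since `‖bᵢ‖ = 1`
    have hn : ‖(b i : Lp ℝ 2 μ)‖ = 1 := b.orthonormal.norm_eq_one i
    calc |@inner ℝ _ _ (b i) (Xop (b i))| ≤ ‖(b i : Lp ℝ 2 μ)‖ * ‖Xop (b i)‖ := abs_real_inner_le_norm _ _
      _ ≤ ‖(b i : Lp ℝ 2 μ)‖ * (‖Xop‖ * ‖(b i : Lp ℝ 2 μ)‖) :=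
          mul_le_mul_of_nonneg_left (Xop.le_opNorm _) (norm_nonneg _)
      _ = ‖Xop‖ := by rw [hn, one_mul, mul_one]
  · intro T M hT hr2 hr1 c Φ hΦ hΦα
    exact hasSum_window_rotated ρ β hρ hρu hβ hT hr2 hr1 c hα hαb hΦ hΦα hA hb hXop

/-! ## §6 The thermodynamic limit of window expectations -/

/-- **THE THERMODYNAMIC (INFINITE EUCLIDEAN TIME) LIMIT OF WINDOW EXPECTATIONS.**  Fix `β ≥ 0`, a continuous unitary `ρ`,
a spatial box `b₁ × b₂ × b₃` and ONE bounded measurable window function `α` of `r + 2` consecutive slices and the `r + 1`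
temporal-link layers between them.  For every sequence of periods `T k → ∞` and measurable observables `Φ k` of the
`Fin`-torus `b₁ × b₂ × b₃ × T k` reading `α` on SOME window `[c, c+r+1]` of the time cycle (whenever it fits), the normalised
expectations `⟨Φ k⟩ = (∫ Φ k · e^{−βS}) / Z(T k)` CONVERGE as `k → ∞`: by §5 `⟨Φ k⟩ = (Σᵢ λᵢ^{M_k+2} aᵢ)/(Σᵢ λᵢ^{M_k+2+(r+1)})`,
`M_k = T k − r − 3 → ∞`, and layer (A) ✓`SpectralSumLimit.tendsto_tsum_pow_mul_div_tsum_pow` (Lüscher positivity only;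
no spectral gap).  This is Montvay–Münster's "finite Euclidean time extent … `N → ∞`" for observables of arbitrary finite
time-width, temporal links included. [cite: MontvayMunster1994, §1.5.2 (1.195)–(1.196)] [cite: Luscher1977] -/
theorem exists_tendsto_window_expectation (hρ : Continuous ρ) (hρu : ∀ g, ρ g ∈ Matrix.unitaryGroup (Fin N) ℂ)
    (hβ : 0 ≤ β) (b₁ b₂ b₃ : ℕ) {r : ℕ}
    (α : (Fin (r + 2) → (FinSpatialSite b₁ b₂ b₃ × Fin 3 → G)) → (Fin (r + 1) → (FinSpatialSite b₁ b₂ b₃ → G)) → ℝ)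
    (hα : Measurable fun q : (Fin (r + 2) → (FinSpatialSite b₁ b₂ b₃ × Fin 3 → G)) ×
      (Fin (r + 1) → (FinSpatialSite b₁ b₂ b₃ → G)) => α q.1 q.2)
    (Cα : ℝ) (hαb : ∀ W γs, |α W γs| ≤ Cα) (T : ℕ → ℕ) (hT : Tendsto T atTop atTop)
    (Φ : ∀ k, (FinTorusSite b₁ b₂ b₃ (T k) × Fin 4 → G) → ℝ) (hΦ : ∀ k, Measurable (Φ k))
    (hΦα : ∀ (k : ℕ) (hr2 : r + 2 ≤ T k) (hr1 : r + 1 ≤ T k), ∃ c : Fin (T k),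
      ∀ VE : (Fin (T k) → (FinSpatialSite b₁ b₂ b₃ × Fin 3 → G)) × (Fin (T k) → (FinSpatialSite b₁ b₂ b₃ → G)),
        Φ k (finTorusAssemble VE) = α (fun i => VE.1 (Fin.castLE hr2 i + c)) (fun i => VE.2 (Fin.castLE hr1 i + c))) :
    ∃ Q : ℝ, Tendsto (fun k => (∫ U, Φ k U * Real.exp (-β * ∑ x : FinTorusSite b₁ b₂ b₃ (T k),
        ∑ q : {q : Fin 4 × Fin 4 // q.1 < q.2}, ((N : ℝ) - (ρ (finTorusPlaquette U x q.1.1 q.1.2)).trace.re))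
        ∂(Measure.pi fun _ : FinTorusSite b₁ b₂ b₃ (T k) × Fin 4 => haarProbability G)) /
        wilsonFinTorusPartition ρ β b₁ b₂ b₃ (T k)) atTop (𝓝 Q) := by
  obtain ⟨s, hs, lam, i₀, hle, hL0, hsq, hZ, hwin⟩ := exists_window_spectralData ρ β hρ hρu hβ b₁ b₂ b₃
  haveI : Countable s := hs
  obtain ⟨a, ⟨Ca, ha⟩, hsum⟩ := hwin r α hα Cα hαb
  have hM : Tendsto (fun k => T k - (r + 3)) atTop atTop := (tendsto_sub_atTop_nat (r + 3)).comp hT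
  obtain ⟨Q, hQ⟩ := SpectralSumLimit.exists_tendsto_tsum_pow_mul_div_tsum_pow (lam := lam) (a := a)
    hL0 (fun i => (hle i).1) (fun i => (hle i).2) hsq ha (i₀ := i₀) rfl (r + 1) hM
  refine ⟨Q, hQ.congr' ?_⟩
  filter_upwards [hT.eventually_ge_atTop (r + 3)] with k hk
  have h2 : r + 2 ≤ T k := by omega
  have h1 : r + 1 ≤ T k := by omega
  obtain ⟨c, hc⟩ := hΦα k h2 h1
  have hs1 := hsum (T k) (T k - (r + 3)) (by omega) h2 h1 c (Φ k) (hΦ k) hc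
  have hZk : HasSum (fun i => lam i ^ (T k - (r + 3) + 2 + (r + 1))) (wilsonFinTorusPartition ρ β b₁ b₂ b₃ (T k)) := by
    have e1 : T k - (r + 3) + 2 + (r + 1) = T k - 2 + 2 := by omega
    have e2 : T k - 2 + 2 = T k := by omega
    have h := hZ (T k - 2)
    rw [e2] at h
    rw [e1, e2]
    exact h
  show _ = _
  rw [hs1.tsum_eq, hZk.tsum_eq]

end Summit.QuantumFields.YangMills.Theorems.FinTorusWindow

end
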